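import Mathlib
import Summits.ValiantsHypothesis.ValiantsHypothesis.Theorems.DivisionGapPerMultiplesHardStubCodegreeMixing

/-!
# Crux `DivisionGap.PerMultiplesHard` (stmt-ValiantsHypothesis-5068), line `uncharged-face-walk` —
# stub `stub_codegreeDeviation`, auxiliary file: regularity bookkeeping (lead c9, cycle 9)

Helpers for `stub_codegreeDeviation` (file `DivisionGapPerMultiplesHardStubCodegreeDeviation`):
a block `X' ⊆ Fin a × Fin a` (rows `e.1`, columns `e.2`) is `ε`-regular at scale `a/P` with
density `p` when every row set `S` and column set `T` with `a ≤ P · #S`, `a ≤ P · #T` span a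
density within `ε` of `p`.
* `e(S, T) = Σ_{x ∈ S} deg_T x` is the landed `CodegreeMixing.card_filter_rect_eq_sum_rows`
  (file `DivisionGapPerMultiplesHardStubCodegreeMixing`, imported).
* `exists_bad_rows` (one application of regularity): for a column set `Y` with `a ≤ P · #Y` the
  rows of degree into `Y` below `(p − ε) #Y` (resp. above `(p + ε) #Y`) number `< a/P` each,
  since otherwise they would span with `Y` a pair of density `< p − ε` (resp. `> p + ε`).
* `sum_le_of_typical`: a sum whose terms are `≤ δ` off an exceptional index set of size `≤ b` and
  `≤ M` everywhere is `≤ n δ + b M` (`n` the number of indices).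
* `window_two`, `window_four`: `(p ± ε)^m = p^m ± 15 ε` for `m ∈ {2, 4}`, `0 ≤ ε ≤ p ≤ 1`.
* `level_one`, `level_two`: the first two levels of the chain `Y₀ = univ`,
  `Y_{i+1} = Y_i ∩ N(x_{i+1})`: a typical step keeps `#Y_i ∈ [(p − ε)^i a, (p + ε)^i a]` (so
  `a ≤ P · #Y_i`, as `P (p − ε)³ ≥ 1`), the last degree is then within `15 ε a + 1` of
  `c ∈ (p^m a − 1, p^m a]`, every term is `≤ a`, and fewer than `2a/P ≤ 2 ε a` rows are atypical
  at each level.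
* `stub_codegreeDeviation_levelTwo`: the closed form of `level_two`, registered as the sub-goal of
  the crux item that this file discharges.

[folklore]  Leans on `CodegreeMixing.card_filter_rect_eq_sum_rows` (tree) and Mathlib.
No definitions.
-/

noncomputable section

-- `Summit.ValiantsHypothesis.ValiantsHypothesis.…` is the tree's mandated single-conjunct layout
-- (Sub = Summit), so the duplicated namespace component is intended.
set_option linter.dupNamespace false

namespace Summit.ValiantsHypothesis.ValiantsHypothesis.Theorems.DivisionGap.PerMultiplesHard.CodegreeDeviation

open Finset
open scoped BigOperators

/-! ### The exceptional rows of a column set -/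

/-- **Key lemma** (one application of regularity). If every pair of a row set and a column set of
sizes `≥ a/P` spans a density within `ε` of `p`, then for every column set `Y` with `a ≤ P · #Y`
all rows outside an exceptional set `B` with `P · #B < 2a` have degree into `Y` in
`[(p - ε) #Y, (p + ε) #Y]`: the rows of low (resp. high) degree span with `Y` a pair of density
`< p - ε` (resp. `> p + ε`), so there are `< a/P` of them. [folklore] -/
theorem exists_bad_rows {a P : ℕ} {X' : Finset (Fin a × Fin a)} {p ε : ℝ} (ha : 1 ≤ a)
    (hreg : ∀ S T : Finset (Fin a), a ≤ P * S.card → a ≤ P * T.card →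
      |(((X'.filter fun e => e.1 ∈ S ∧ e.2 ∈ T).card : ℕ) : ℝ) / ((S.card : ℝ) * (T.card : ℝ)) -
        p| ≤ ε)
    (Y : Finset (Fin a)) (hY : a ≤ P * Y.card) :
    ∃ B : Finset (Fin a), (P : ℝ) * B.card < 2 * a ∧
      ∀ x, x ∉ B → (p - ε) * Y.card ≤ ((Y.filter fun y => (x, y) ∈ X').card : ℝ) ∧
        ((Y.filter fun y => (x, y) ∈ X').card : ℝ) ≤ (p + ε) * Y.card := by
  -- the density against `Y` of every large enough row set `S` is within `ε` of `p`
  have key : ∀ S : Finset (Fin a), a ≤ P * S.card →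
      (p - ε) * (S.card * Y.card) ≤ ∑ x ∈ S, ((Y.filter fun y => (x, y) ∈ X').card : ℝ) ∧
        ∑ x ∈ S, ((Y.filter fun y => (x, y) ∈ X').card : ℝ) ≤ (p + ε) * (S.card * Y.card) := by
    intro S hS
    have hSpos : 0 < S.card := by
      rcases Nat.eq_zero_or_pos S.card with h0 | h0
      · rw [h0, mul_zero] at hS; omega
      · exact h0
    have hYpos : 0 < Y.card := by
      rcases Nat.eq_zero_or_pos Y.card with h0 | h0
      · rw [h0, mul_zero] at hY; omega
      · exact h0
    have hpos : (0 : ℝ) < (S.card : ℝ) * (Y.card : ℝ) := by positivity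
    have hsum : (((X'.filter fun e => e.1 ∈ S ∧ e.2 ∈ Y).card : ℕ) : ℝ) =
        ∑ x ∈ S, ((Y.filter fun y => (x, y) ∈ X').card : ℝ) := by
      rw [CodegreeMixing.card_filter_rect_eq_sum_rows X' S Y, Nat.cast_sum]
    have h := hreg S Y hS hY
    rw [hsum] at h
    obtain ⟨h1, h2⟩ := abs_sub_le_iff.1 h
    constructor
    · have h3 : p - ε ≤ (∑ x ∈ S, ((Y.filter fun y => (x, y) ∈ X').card : ℝ)) /
          ((S.card : ℝ) * (Y.card : ℝ)) := by linarith
      rwa [le_div_iff₀ hpos] at h3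
    · have h3 : (∑ x ∈ S, ((Y.filter fun y => (x, y) ∈ X').card : ℝ)) /
          ((S.card : ℝ) * (Y.card : ℝ)) ≤ p + ε := by linarith
      rwa [div_le_iff₀ hpos] at h3
  obtain ⟨L, hL⟩ : ∃ L : Finset (Fin a), L = Finset.univ.filter fun x =>
      ((Y.filter fun y => (x, y) ∈ X').card : ℝ) < (p - ε) * Y.card := ⟨_, rfl⟩
  obtain ⟨H, hH⟩ : ∃ H : Finset (Fin a), H = Finset.univ.filter fun x =>
      (p + ε) * Y.card < ((Y.filter fun y => (x, y) ∈ X').card : ℝ) := ⟨_, rfl⟩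
  have hLlt : P * L.card < a := by
    refine Nat.lt_of_not_le fun hcon => ?_
    have hLne : L.Nonempty := by
      rw [← Finset.card_pos]
      rcases Nat.eq_zero_or_pos L.card with h0 | h0
      · rw [h0, mul_zero] at hcon; omega
      · exact h0
    obtain ⟨h1, -⟩ := key L hcon
    have hlt : ∑ x ∈ L, ((Y.filter fun y => (x, y) ∈ X').card : ℝ) <
        ∑ x ∈ L, (p - ε) * (Y.card : ℝ) :=
      Finset.sum_lt_sum_of_nonempty hLne fun x hx => by
        rw [hL, Finset.mem_filter] at hx
        exact hx.2
    rw [Finset.sum_const, nsmul_eq_mul] at hlt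
    linarith
  have hHlt : P * H.card < a := by
    refine Nat.lt_of_not_le fun hcon => ?_
    have hHne : H.Nonempty := by
      rw [← Finset.card_pos]
      rcases Nat.eq_zero_or_pos H.card with h0 | h0
      · rw [h0, mul_zero] at hcon; omega
      · exact h0
    obtain ⟨-, h2⟩ := key H hcon
    have hlt : ∑ x ∈ H, (p + ε) * (Y.card : ℝ) <
        ∑ x ∈ H, ((Y.filter fun y => (x, y) ∈ X').card : ℝ) :=
      Finset.sum_lt_sum_of_nonempty hHne fun x hx => by
        rw [hH, Finset.mem_filter] at hx
        exact hx.2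
    rw [Finset.sum_const, nsmul_eq_mul] at hlt
    linarith
  refine ⟨L ∪ H, ?_, fun x hx => ?_⟩
  · have h1 : ((L ∪ H).card : ℝ) ≤ L.card + H.card := by exact_mod_cast Finset.card_union_le L H
    have h2 : (P : ℝ) * L.card < a := by exact_mod_cast hLlt
    have h3 : (P : ℝ) * H.card < a := by exact_mod_cast hHlt
    have hP : (0 : ℝ) ≤ P := Nat.cast_nonneg P
    calc (P : ℝ) * ((L ∪ H).card : ℝ) ≤ P * (L.card + H.card) := mul_le_mul_of_nonneg_left h1 hP
      _ = P * L.card + P * H.card := by ring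
      _ < 2 * a := by linarith
  · rw [Finset.mem_union, not_or, hL, hH] at hx
    simp only [Finset.mem_filter, Finset.mem_univ, true_and, not_lt] at hx
    exact hx

/-! ### Bookkeeping: typical and crude bounds -/

/-- A sum whose terms are at most `δ` outside an exceptional index set `B` with `#B ≤ b`, and at
most `M` everywhere, over at most `n` indices, is at most `n δ + b M`. [folklore] -/
theorem sum_le_of_typical {ι : Type*} (s B : Finset ι) (g : ι → ℝ) {δ M n b : ℝ}
    (hδ : 0 ≤ δ) (hM : 0 ≤ M) (hs : (s.card : ℝ) ≤ n) (hB : (B.card : ℝ) ≤ b)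
    (hall : ∀ i ∈ s, g i ≤ M) (htyp : ∀ i ∈ s, i ∉ B → g i ≤ δ) :
    ∑ i ∈ s, g i ≤ n * δ + b * M := by
  classical
  rw [← Finset.sum_filter_add_sum_filter_not s (fun i => i ∈ B) g]
  have h1 : ∑ i ∈ s.filter (fun i => i ∈ B), g i ≤ b * M := by
    refine (Finset.sum_le_card_nsmul _ _ M fun i hi => hall i (Finset.mem_filter.1 hi).1).trans ?_
    rw [nsmul_eq_mul]
    refine mul_le_mul_of_nonneg_right (le_trans ?_ hB) hM
    exact_mod_cast Finset.card_le_card fun i hi => (Finset.mem_filter.1 hi).2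
  have h2 : ∑ i ∈ s.filter (fun i => ¬i ∈ B), g i ≤ n * δ := by
    refine (Finset.sum_le_card_nsmul _ _ δ fun i hi =>
      htyp i (Finset.mem_filter.1 hi).1 (Finset.mem_filter.1 hi).2).trans ?_
    rw [nsmul_eq_mul]
    refine mul_le_mul_of_nonneg_right (le_trans ?_ hs) hδ
    exact_mod_cast Finset.card_le_card (Finset.filter_subset _ s)
  linarith

/-- A set of rows has at most `a` elements. [folklore] -/
theorem card_le_side {a : ℕ} (s : Finset (Fin a)) : (s.card : ℝ) ≤ a := by
  have h := Finset.card_le_univ s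
  rw [Fintype.card_fin] at h
  exact_mod_cast h

/-- Crude bound: a degree and a typical value `c ∈ [0, a]` differ by at most `a`. [folklore] -/
theorem abs_degree_sub_le {a : ℕ} (X' : Finset (Fin a × Fin a)) (Y : Finset (Fin a)) (x : Fin a)
    {c : ℝ} (hc0 : 0 ≤ c) (hca : c ≤ a) :
    |((Y.filter fun y => (x, y) ∈ X').card : ℝ) - c| ≤ a := by
  have h1 := card_le_side (Y.filter fun y => (x, y) ∈ X')
  have h2 : (0 : ℝ) ≤ ((Y.filter fun y => (x, y) ∈ X').card : ℝ) := Nat.cast_nonneg _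
  rw [abs_sub_le_iff]
  constructor <;> linarith

/-- A sum over a set of rows of terms bounded by `M ≥ 0` is at most `a M`. [folklore] -/
theorem sum_le_side_mul {a : ℕ} (s : Finset (Fin a)) (g : Fin a → ℝ) {M : ℝ} (hM : 0 ≤ M)
    (h : ∀ x ∈ s, g x ≤ M) : ∑ x ∈ s, g x ≤ a * M := by
  refine (Finset.sum_le_card_nsmul s g M h).trans ?_
  rw [nsmul_eq_mul]
  exact mul_le_mul_of_nonneg_right (card_le_side s) hM

/-- A column set of size `≥ q^k a` (`k ≤ 3`, `0 ≤ q ≤ 1`) is large at scale `a/P` once `P q³ ≥ 1`.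
[folklore] -/
theorem side_le_of_le_card {a P k : ℕ} {q : ℝ} {Y : Finset (Fin a)} (hk : k ≤ 3) (hq0 : 0 ≤ q)
    (hq1 : q ≤ 1) (hPq : 1 ≤ (P : ℝ) * q ^ 3) (hY : q ^ k * a ≤ (Y.card : ℝ)) :
    a ≤ P * Y.card := by
  have h1 : q ^ 3 ≤ q ^ k := pow_le_pow_of_le_one hq0 hq1 hk
  have ha : (0 : ℝ) ≤ a := Nat.cast_nonneg a
  have hP : (0 : ℝ) ≤ P := Nat.cast_nonneg P
  have h2 : (a : ℝ) ≤ (P : ℝ) * (Y.card : ℝ) :=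
    calc (a : ℝ) = 1 * a := (one_mul _).symm
      _ ≤ (P : ℝ) * q ^ 3 * a := mul_le_mul_of_nonneg_right hPq ha
      _ ≤ (P : ℝ) * q ^ k * a := mul_le_mul_of_nonneg_right (mul_le_mul_of_nonneg_left h1 hP) ha
      _ = (P : ℝ) * (q ^ k * a) := by ring
      _ ≤ (P : ℝ) * Y.card := mul_le_mul_of_nonneg_left hY hP
  exact_mod_cast h2

/-- A typical degree `d ∈ [(p - ε)^m A, (p + ε)^m A]` is within `15 ε A + 1` of any
`c ∈ (p^m A - 1, p^m A]`, provided `(p ± ε)^m` is within `15 ε` of `p^m`. [folklore] -/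
theorem abs_sub_le_of_window {m : ℕ} {p ε c d A : ℝ} (hA : 0 ≤ A)
    (h15 : (p + ε) ^ m ≤ p ^ m + 15 * ε) (h15' : p ^ m ≤ (p - ε) ^ m + 15 * ε)
    (hc1 : c ≤ p ^ m * A) (hc2 : p ^ m * A < c + 1)
    (hlo : (p - ε) ^ m * A ≤ d) (hhi : d ≤ (p + ε) ^ m * A) : |d - c| ≤ 15 * ε * A + 1 := by
  have h1 := mul_le_mul_of_nonneg_right h15 hA
  have h2 := mul_le_mul_of_nonneg_right h15' hA
  rw [abs_sub_le_iff]
  constructor <;> linarith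

/-- Typical degrees propagate the size window one level down the chain. [folklore] -/
theorem window_succ {k : ℕ} {q r A n d : ℝ} (hq : 0 ≤ q) (hr : 0 ≤ r)
    (hlo : q ^ k * A ≤ n) (hhi : n ≤ r ^ k * A) (hdlo : q * n ≤ d) (hdhi : d ≤ r * n) :
    q ^ (k + 1) * A ≤ d ∧ d ≤ r ^ (k + 1) * A := by
  constructor
  · calc q ^ (k + 1) * A = q * (q ^ k * A) := by ring
      _ ≤ q * n := mul_le_mul_of_nonneg_left hlo hq
      _ ≤ d := hdlo
  · calc d ≤ r * n := hdhi
      _ ≤ r * (r ^ k * A) := mul_le_mul_of_nonneg_left hhi hr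
      _ = r ^ (k + 1) * A := by ring

/-- `(p + ε)² ≤ p² + 15 ε` and `p² ≤ (p - ε)² + 15 ε` for `0 ≤ ε ≤ p ≤ 1`. [folklore] -/
theorem window_two {p ε : ℝ} (hε0 : 0 ≤ ε) (hεp : ε ≤ p) (hp1 : p ≤ 1) :
    (p + ε) ^ 2 ≤ p ^ 2 + 15 * ε ∧ p ^ 2 ≤ (p - ε) ^ 2 + 15 * ε := by
  have h1 : p * ε ≤ 1 * ε := mul_le_mul_of_nonneg_right hp1 hε0
  have h2 : ε * ε ≤ 1 * ε := mul_le_mul_of_nonneg_right (hεp.trans hp1) hε0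
  constructor <;> nlinarith

/-- `(p + ε)⁴ ≤ p⁴ + 15 ε` and `p⁴ ≤ (p - ε)⁴ + 15 ε` for `0 ≤ ε ≤ p ≤ 1`. [folklore] -/
theorem window_four {p ε : ℝ} (hε0 : 0 ≤ ε) (hεp : ε ≤ p) (hp1 : p ≤ 1) :
    (p + ε) ^ 4 ≤ p ^ 4 + 15 * ε ∧ p ^ 4 ≤ (p - ε) ^ 4 + 15 * ε := by
  have hp0 : 0 ≤ p := hε0.trans hεp
  have hε1 : ε ≤ 1 := hεp.trans hp1
  have hpp : p ^ 2 ≤ 1 := pow_le_one₀ hp0 hp1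
  constructor
  · have key : (p + ε) ^ 4 = p ^ 4 + ε * ((p + ε + p) * ((p + ε) ^ 2 + p ^ 2)) := by ring
    have h1 : p + ε + p ≤ 3 := by linarith
    have h2 : (p + ε) ^ 2 + p ^ 2 ≤ 5 := by
      have : (p + ε) ^ 2 ≤ 2 ^ 2 := pow_le_pow_left₀ (by linarith) (by linarith) 2
      linarith
    have h3 : (p + ε + p) * ((p + ε) ^ 2 + p ^ 2) ≤ 3 * 5 :=
      mul_le_mul h1 h2 (by positivity) (by norm_num)
    rw [key]
    nlinarith [mul_le_mul_of_nonneg_left h3 hε0]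
  · have key : p ^ 4 = (p - ε) ^ 4 + ε * ((p + (p - ε)) * (p ^ 2 + (p - ε) ^ 2)) := by ring
    have h0 : 0 ≤ p - ε := sub_nonneg.2 hεp
    have h1 : p + (p - ε) ≤ 2 := by linarith
    have h2 : p ^ 2 + (p - ε) ^ 2 ≤ 2 := by
      have : (p - ε) ^ 2 ≤ 1 ^ 2 := pow_le_pow_left₀ h0 (by linarith) 2
      linarith
    have h3 : (p + (p - ε)) * (p ^ 2 + (p - ε) ^ 2) ≤ 2 * 2 :=
      mul_le_mul h1 h2 (by positivity) (by norm_num)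
    rw [key]
    nlinarith [mul_le_mul_of_nonneg_left h3 hε0]

/-! ### The levels of the chain `Y₀ = univ ⊇ Y₁ = N(x₁) ⊇ Y₂ = Y₁ ∩ N(x₂) ⊇ ⋯` -/

/-- Level 1 (innermost sum). For a column set `Y` with `#Y ∈ [(p - ε)^k a, (p + ε)^k a]`, the
degrees into `Y` of the rows of a row set `s` deviate from `c ∈ (p^m a - 1, p^m a]` (`m = k + 1`)
by at most `a (15 ε a + 1) + 2 ε a · a` in total. [folklore] -/
theorem level_one {a P k m : ℕ} {X' : Finset (Fin a × Fin a)} {p ε c : ℝ} (ha : 1 ≤ a)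
    (hreg : ∀ S T : Finset (Fin a), a ≤ P * S.card → a ≤ P * T.card →
      |(((X'.filter fun e => e.1 ∈ S ∧ e.2 ∈ T).card : ℕ) : ℝ) / ((S.card : ℝ) * (T.card : ℝ)) -
        p| ≤ ε)
    (hPε : (P : ℝ) * ε = 1) (hε0 : 0 ≤ ε) (hεp : ε ≤ p) (hp1 : p ≤ 1)
    (hPq : 1 ≤ (P : ℝ) * (p - ε) ^ 3) (hk : k ≤ 3) (hm : m = k + 1)
    (h15 : (p + ε) ^ m ≤ p ^ m + 15 * ε) (h15' : p ^ m ≤ (p - ε) ^ m + 15 * ε)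
    (hc0 : 0 ≤ c) (hca : c ≤ a) (hc1 : c ≤ p ^ m * a) (hc2 : p ^ m * a < c + 1)
    (Y : Finset (Fin a)) (hlo : (p - ε) ^ k * a ≤ Y.card) (hhi : (Y.card : ℝ) ≤ (p + ε) ^ k * a)
    (s : Finset (Fin a)) :
    ∑ x ∈ s, |((Y.filter fun y => (x, y) ∈ X').card : ℝ) - c| ≤
      a * (15 * ε * a + 1) + 2 * ε * a * a := by
  have hq0 : 0 ≤ p - ε := sub_nonneg.2 hεp
  have hq1 : p - ε ≤ 1 := by linarith
  obtain ⟨B, hB, hBtyp⟩ := exists_bad_rows ha hreg Y (side_le_of_le_card hk hq0 hq1 hPq hlo)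
  have hBε : (B.card : ℝ) ≤ 2 * ε * a :=
    calc (B.card : ℝ) = ε * ((P : ℝ) * B.card) := by rw [← mul_assoc, mul_comm ε, hPε, one_mul]
      _ ≤ ε * (2 * a) := mul_le_mul_of_nonneg_left hB.le hε0
      _ = 2 * ε * a := by ring
  refine sum_le_of_typical s B _ (by positivity) (Nat.cast_nonneg a) (card_le_side s) hBε
    (fun x _ => abs_degree_sub_le X' Y x hc0 hca) fun x _ hx => ?_
  obtain ⟨hdlo, hdhi⟩ := hBtyp x hx
  obtain ⟨hlo', hhi'⟩ := window_succ hq0 (by linarith) hlo hhi hdlo hdhi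
  subst hm
  exact abs_sub_le_of_window (Nat.cast_nonneg a) h15 h15' hc1 hc2 hlo' hhi'

/-- Level 2. For a column set `Y` with `#Y ∈ [(p - ε)^k a, (p + ε)^k a]`, the double sum over
rows `x ∈ s`, `x' ∈ t x` of the deviations from `c ∈ (p^m a - 1, p^m a]` (`m = k + 2`) of the
degrees of `x'` into `Y ∩ N(x)`. [folklore] -/
theorem level_two {a P k m : ℕ} {X' : Finset (Fin a × Fin a)} {p ε c : ℝ} (ha : 1 ≤ a)
    (hreg : ∀ S T : Finset (Fin a), a ≤ P * S.card → a ≤ P * T.card →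
      |(((X'.filter fun e => e.1 ∈ S ∧ e.2 ∈ T).card : ℕ) : ℝ) / ((S.card : ℝ) * (T.card : ℝ)) -
        p| ≤ ε)
    (hPε : (P : ℝ) * ε = 1) (hε0 : 0 ≤ ε) (hεp : ε ≤ p) (hp1 : p ≤ 1)
    (hPq : 1 ≤ (P : ℝ) * (p - ε) ^ 3) (hk : k + 1 ≤ 3) (hm : m = k + 2)
    (h15 : (p + ε) ^ m ≤ p ^ m + 15 * ε) (h15' : p ^ m ≤ (p - ε) ^ m + 15 * ε)
    (hc0 : 0 ≤ c) (hca : c ≤ a) (hc1 : c ≤ p ^ m * a) (hc2 : p ^ m * a < c + 1)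
    (Y : Finset (Fin a)) (hlo : (p - ε) ^ k * a ≤ Y.card) (hhi : (Y.card : ℝ) ≤ (p + ε) ^ k * a)
    (s : Finset (Fin a)) (t : Fin a → Finset (Fin a)) :
    ∑ x ∈ s, ∑ x' ∈ t x,
        |(((Y.filter fun y => (x, y) ∈ X').filter fun y => (x', y) ∈ X').card : ℝ) - c| ≤
      a * (a * (15 * ε * a + 1) + 2 * ε * a * a) + 2 * ε * a * (a * a) := by
  have hq0 : 0 ≤ p - ε := sub_nonneg.2 hεp
  have hq1 : p - ε ≤ 1 := by linarith
  obtain ⟨B, hB, hBtyp⟩ :=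
    exists_bad_rows ha hreg Y (side_le_of_le_card (le_trans (by omega) hk) hq0 hq1 hPq hlo)
  have hBε : (B.card : ℝ) ≤ 2 * ε * a :=
    calc (B.card : ℝ) = ε * ((P : ℝ) * B.card) := by rw [← mul_assoc, mul_comm ε, hPε, one_mul]
      _ ≤ ε * (2 * a) := mul_le_mul_of_nonneg_left hB.le hε0
      _ = 2 * ε * a := by ring
  refine sum_le_of_typical s B _ (by positivity) (by positivity) (card_le_side s) hBε
    (fun x _ => sum_le_side_mul (t x) _ (Nat.cast_nonneg a) fun x' _ =>
      abs_degree_sub_le X' (Y.filter fun y => (x, y) ∈ X') x' hc0 hca)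
    fun x _ hx => ?_
  obtain ⟨hdlo, hdhi⟩ := hBtyp x hx
  obtain ⟨hlo', hhi'⟩ := window_succ hq0 (by linarith) hlo hhi hdlo hdhi
  exact level_one (k := k + 1) (m := m) ha hreg hPε hε0 hεp hp1 hPq hk (by omega) h15 h15' hc0
    hca hc1 hc2 (Y.filter fun y => (x, y) ∈ X') hlo' hhi' (t x)

/-- Closed form of `level_two`: the registered sub-goal `stub_codegreeDeviation_levelTwo` of the
crux item that this auxiliary file discharges (the main file applies it from `Y₀ = univ` for the
codegrees and, through two more levels, for the 4-wise intersections). [folklore] -/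
theorem stub_codegreeDeviation_levelTwo :
    ∀ (a P k m : ℕ) (X' : Finset (Fin a × Fin a)) (p ε c : ℝ), 1 ≤ a →
      (∀ S T : Finset (Fin a), a ≤ P * S.card → a ≤ P * T.card →
        |(((X'.filter fun e => e.1 ∈ S ∧ e.2 ∈ T).card : ℕ) : ℝ) / ((S.card : ℝ) * (T.card : ℝ)) -
          p| ≤ ε) →
      (P : ℝ) * ε = 1 → 0 ≤ ε → ε ≤ p → p ≤ 1 → 1 ≤ (P : ℝ) * (p - ε) ^ 3 → k + 1 ≤ 3 →
      m = k + 2 → (p + ε) ^ m ≤ p ^ m + 15 * ε → p ^ m ≤ (p - ε) ^ m + 15 * ε → 0 ≤ c →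
      c ≤ a → c ≤ p ^ m * a → p ^ m * a < c + 1 → ∀ (Y : Finset (Fin a)),
      (p - ε) ^ k * a ≤ Y.card → (Y.card : ℝ) ≤ (p + ε) ^ k * a →
      ∀ (s : Finset (Fin a)) (t : Fin a → Finset (Fin a)),
      ∑ x ∈ s, ∑ x' ∈ t x,
          |((((Y.filter fun y => (x, y) ∈ X').filter fun y => (x', y) ∈ X').card : ℕ) : ℝ) - c| ≤
        a * (a * (15 * ε * a + 1) + 2 * ε * a * a) + 2 * ε * a * (a * a) :=
  fun _ _ _ _ _ _ _ _ ha hreg hPε hε0 hεp hp1 hPq hk hm h15 h15' hc0 hca hc1 hc2 Y hlo hhi s t =>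
    level_two ha hreg hPε hε0 hεp hp1 hPq hk hm h15 h15' hc0 hca hc1 hc2 Y hlo hhi s t

end Summit.ValiantsHypothesis.ValiantsHypothesis.Theorems.DivisionGap.PerMultiplesHard.CodegreeDeviation
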